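import Summits.ValiantsHypothesis.ValiantsHypothesis.Theses.FifoMatching
import Summits.ValiantsHypothesis.ValiantsHypothesis.Theorems.FifoMatchingNCInVPCircuit
import Summits.ValiantsHypothesis.ValiantsHypothesis.Theorems.FifoMatchingNCMatchingSum
import HarnessLib

/-!
# `FifoMatching.NCInVP`: noncrossing perfect matchings are in VP

Closes item `stmt-ValiantsHypothesis-11619`: the family
`NC_n = Σ_{M noncrossing perfect matching of [2n]} ∏_{i<M i} x_{i,M i}` is a VP family, by the
`O(n³)` interval DP `NC[i,j) = Σ_a x_{i,a} NC[i+1,a) NC[a+1,j)` realised as a fan-in-two circuit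
(`isVPFamily_ncRec`, file `FifoMatchingNCInVPCircuit.lean`) and the first-arc decomposition
(`sum_wt_eq`, file `FifoMatchingNCMatchingSum.lean`).
-/

noncomputable section

-- layout Summits/ValiantsHypothesis/ValiantsHypothesis forces the duplicated namespace component
set_option linter.dupNamespace false

namespace Summit.ValiantsHypothesis.ValiantsHypothesis.Theorems.FifoMatching

open MvPolynomial

/-- The item's matching predicate on all of `Fin N` is `IsNCOn 0 N`. [folklore] -/
theorem isNCOn_zero_iff {N : ℕ} (M : Fin N → Fin N) :
    IsNCOn 0 N M ↔
      ((∀ i, M (M i) = i) ∧ (∀ i, M i ≠ i) ∧ ∀ i j, i < j → j < M i → M i < M j → False) := by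
  constructor
  · rintro ⟨-, h2, h3⟩
    exact ⟨fun x => (h2 x (Nat.zero_le _) x.isLt).2.2.1, fun x => (h2 x (Nat.zero_le _) x.isLt).2.2.2,
      h3⟩
  · rintro ⟨h1, h2, h3⟩
    refine ⟨fun x hx => ?_, fun x _ _ => ⟨Nat.zero_le _, (M x).isLt, h1 x, h2 x⟩, h3⟩
    rcases hx with hx | hx
    · exact absurd hx (Nat.not_lt_zero _)
    · exact absurd x.isLt (Nat.not_lt.mpr hx)

open scoped Classical in
/-- The noncrossing-matching polynomial equals the DP value `NC[0,2n)`. [folklore] -/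
theorem sum_matchings_eq_ncRec (n : ℕ) :
    (∑ M : Fin (2 * n) → Fin (2 * n),
        if ((∀ i, M (M i) = i) ∧ (∀ i, M i ≠ i) ∧ ∀ i j, i < j → j < M i → M i < M j → False) then
          ∏ i : Fin (2 * n), (if i < M i then MvPolynomial.X (i, M i) else 1)
        else (0 : MvPolynomial (Fin (2 * n) × Fin (2 * n)) ℂ)) = ncRec ℂ n 0 (2 * n) := by
  have hsum : (∑ M : Fin (2 * n) → Fin (2 * n),
        if ((∀ i, M (M i) = i) ∧ (∀ i, M i ≠ i) ∧ ∀ i j, i < j → j < M i → M i < M j → False) then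
          ∏ i : Fin (2 * n), (if i < M i then MvPolynomial.X (i, M i) else 1)
        else (0 : MvPolynomial (Fin (2 * n) × Fin (2 * n)) ℂ)) =
      ∑ M ∈ Finset.univ.filter (fun M : Fin (2 * n) → Fin (2 * n) => IsNCOn 0 (2 * n) M),
        wt ℂ M := by
    rw [Finset.sum_filter]
    refine Finset.sum_congr rfl fun M _ => ?_
    by_cases hM : IsNCOn 0 (2 * n) M
    · rw [if_pos hM, if_pos ((isNCOn_zero_iff M).1 hM)]
      rfl
    · rw [if_neg hM, if_neg (fun h => hM ((isNCOn_zero_iff M).2 h))]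
  rw [hsum]
  refine sum_wt_eq (ncRec ℂ n) (xv ℂ n) (fun i a hi ha => ?_) (fun i j h => ncRec_of_le n h)
    (fun i j h _ => ?_) (2 * n) 0 (2 * n) (by omega) (Nat.zero_le _) le_rfl
  · unfold xv
    rw [dif_pos ⟨hi, ha⟩]
  · rw [ncRec_of_lt n h]
    rfl

/-- **Item `stmt-ValiantsHypothesis-11619`** (`FifoMatching.NCInVP`): the noncrossing perfect
matching polynomials form a VP family. [folklore] -/
theorem ncInVP_proof : Summit.ValiantsHypothesis.ValiantsHypothesis.Theses.FifoMatching.NCInVP := by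
  unfold Summit.ValiantsHypothesis.ValiantsHypothesis.Theses.FifoMatching.NCInVP
  have hfam : (fun n => ∑ M : Fin (2 * n) → Fin (2 * n),
        if ((∀ i, M (M i) = i) ∧ (∀ i, M i ≠ i) ∧ ∀ i j, i < j → j < M i → M i < M j → False) then
          ∏ i : Fin (2 * n), (if i < M i then MvPolynomial.X (i, M i) else 1)
        else (0 : MvPolynomial (Fin (2 * n) × Fin (2 * n)) ℂ)) = fun n => ncRec ℂ n 0 (2 * n) := by
    funext n
    convert sum_matchings_eq_ncRec n
  rw [hfam]
  exact isVPFamily_ncRec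

end Summit.ValiantsHypothesis.ValiantsHypothesis.Theorems.FifoMatching

end
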